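import Summits.QuantumFields.BalabanUV.Beta.GAN24.WSlotForcingZeroMode
import Summits.QuantumFields.BalabanUV.Beta.MixedJetTablesPlug

/-!
# `BalabanUV.Beta.GAN24.WSlotForcingZeroModeRoot` — binder row G-an2-4 / (CONV-C), W-slot road «W3», ROW W3-F2b (`hZf` as a function of ROW W3-F2a, both `Zfree` forms) AT THE ROOTED BORDER `vh₂SAt (toSite r) Lc` — decl-by-decl twin of leaf-18's `WSlotForcingZeroMode`

NOT IN PRINT; OUR PROOF ATTEMPT (row owner b2b-balaban-gan24-p1, gen 6; referee r53 (w9) ROOT ALIGNMENT, row (B) of `HOME/b2b-balaban-gan24-p1/SLOT-COVERAGE.md`: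
the β-lead's literal `MixedJetTablesPlug.JsBalAn1` / `JsBalAn1Ctr` — road BF-x's family — has an1's ROOTED border `vh₂SAt (toSite r) Lc`, `r ∈ box (d+1) Lc`, where the
W3 chain of record has the base border `vh₂S d Lc = vh₂SAt 0 Lc`).  [folklore] bookkeeping: the proofs of the base module VERBATIM, the border entering only through
an1's rooted lemmas (`MixedJetTablesPlug.hB_an1` / `hBt_an1`, `AveragingMixedJetTables.biLoc_vh₂SAt`, `T2OfDiffCovariance.vh₂SAt_inl_inl'`, leaf-19/20/11/04's
`…_at` / `…_an1` rows) instead of `T2SlotUnits.locStencil₂_vh₂S` / `vh₂S_inl_inl`.  Same theorem names as the base module, in this namespace.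
HONEST FRAMING (cell contract, verbatim): «discharging `BetaPertH` makes Bałaban's UV stability UNCONDITIONAL — a real constructive-QFT result; it is NOT the continuum
limit and NOT the Clay problem.»  HONEST DEPENDENCY (verbatim): «continuum YM on T⁴ ⇐ BetaPertH ∧ nine spine estimates (0/9 proved); BetaPertH ⇐ (D1) ∧ (D4) ∧ CAP+tail;
G-an2-4 gates asym, D1 and NE2/3/4.»  Discharges NOTHING of (hW, hWall) by itself; every row hypothesis of the base module stays a hypothesis here; 0 `def`, 0 cite,
0 `def … : Prop`, 0 sorry; NOT «W-slot closed», NEVER «G-an2-4 closed», NOT (CONV-C) for `G_k/H_k`; NOT BetaPertH, NOT continuum, NOT Clay.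
-/

noncomputable section

open Finset
open scoped BigOperators
open Literature.MathematicalPhysics.QuantumFieldTheory
open Literature.MathematicalPhysics.QuantumFieldTheory.Balaban1983to89
open Literature.MathematicalPhysics.QuantumFieldTheory.Balaban1983to89.Beta
open ExpKernelCalculus (MKer Decays shiftK)
open OneStepResolventKernel (Fib)
open OneStepKernelFamily (KInvStep decays_KInvStep)
open StepJetData (mfNeg)
open BalabanCompositeJets (LocStencil₂)
open SecondOrderResponse (LocStencilFM W2SymOfK)
open BalabanStepJetsSucc (mmRead)
open BalabanStepW2 (K3OfK Spure M1 M2Of T2Of T2Of_loc locStencil₂_smul' locStencil₂_add')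
open AveragingMixedJetTables (vh₂SAt)
open Summit.QuantumFields.BalabanUV.Beta.HessKerDressedUnits (unitK unitS decays_unitK)
open Summit.QuantumFields.BalabanUV.Beta.SecondOrderUnits (unitM unitS₂ unitM₂)
open Summit.QuantumFields.BalabanUV.Beta.GAN24.CombesThomas (sfStep smStep)
open Summit.QuantumFields.BalabanUV.Beta.GAN24.T2RecursionAffine (lin4)
open Summit.QuantumFields.BalabanUV.Beta.GAN24.BiStencilZeroMode (Tab zmode)
open Summit.QuantumFields.BalabanUV.Beta.GAN24.TransversalZeroModeLoc (inner_add_of_locStencil₂ inner_sub_of_locStencil₂)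
open Summit.QuantumFields.BalabanUV.Beta.GAN24.T2SlotCovariance (unitS₂_T2Of_translate_at)
open Summit.QuantumFields.BalabanUV.Beta.GAN24.WSlotFirstDiff (locStencil₂_unitS₂ zmode_add zmode_sub)
open Summit.QuantumFields.BalabanUV.Beta.GAN24.Lin4ZeroMode (locStencil₂_lin4 inner_lin4_sub_lin4_step zmode_lin4_sub_lin4_step)
open AffineAveraging (box toSite)
open Summit.QuantumFields.BalabanUV.Beta.MixedJetTablesPlug (hB_an1)
open Summit.QuantumFields.BalabanUV.Beta.GAN24.WSlotForcingZeroMode (locStencil₂_sub)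

namespace Summit.QuantumFields.BalabanUV.Beta.GAN24.WSlotForcingZeroModeRoot

variable {d : ℕ}

/-! ## §3 ROW W3-F2b: the forcing of the difference tower is zero-mode-free, GIVEN ROW W3-F2a -/

section Forcing

variable {Lc : ℕ} [NeZero Lc] {r : Fin (d + 1) → ℕ}

/-- [folklore] **EVERY MEMBER OF THE NORMALISED STAGE-B FAMILY IS A `LocStencil₂` TABLE** (member-wise, SOME rate `δ_j > 0` — an2's
`BalabanStepW2.T2Of_loc` at `j` transported through `unitS₂` by leaf-07's `WSlotFirstDiff.locStencil₂_unitS₂`; no `j`-uniformity is claimed: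
that is «T2Shape»). -/
theorem shape_member (hLc : 1 ≤ Lc) (hr : r ∈ box (d + 1) Lc) (cE cVH cΛ cE₂ cB : ℝ) (Tc : Fin 4 → Fin 4 → Fin 4 → Fin 4 → ℝ)
    {mixFF : Tab d} (hmix : ∃ C δ : ℝ, 0 < δ ∧ LocStencilFM Lc mixFF C δ) (j : ℕ) :
    ∃ C δ : ℝ, 0 < δ ∧ LocStencil₂ (unitS₂ (sfStep Lc j) (smStep d Lc j) (T2Of d Lc cE cVH cΛ cE₂ cB Tc (vh₂SAt (toSite r) Lc) mixFF j)) C δ := by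
  obtain ⟨A, δa, hδa, h⟩ := T2Of_loc hLc cE cVH cΛ cE₂ cB Tc (hB_an1 hLc hr) hmix j
  exact ⟨_, δa, hδa, locStencil₂_unitS₂ (sfStep Lc j) (smStep d Lc j) h⟩

/-- **ROW W3-F2b FROM ROW W3-F2a — POINTWISE TRANSVERSAL FORM OF RECORD (ref2 R51-2 ∕ (w2))** [folklore composition].
For an2's normalised Stage-B family `T♮_j := unitS₂ (sfStep Lc j) (smStep d Lc j) (T2Of d Lc cE cVH cΛ cE₂ cB Tc (vh₂SAt (toSite r) Lc) mixFF j)` with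
linear parts `𝒜_j := lin4 (cE₂·Lc^{2(d+1)}) K♮_j Lc` (leaf-04) and ANY source family `b` of `LocStencil₂` tables (ROW W3-F4a's shape conjunct)
whose field–field transversal inner sums vanish pointwise (ROW W3-F2a, `hZ`), the FORCING of the difference tower
`f m := (𝒜_{m+1} T♮_m − 𝒜_m T♮_m) + (b (m+1) − b m)` (leaf-01's `AffineUnroll` §4, `Pi` form) has vanishing field–field transversal inner
sums at EVERY first bond — `hZf : ∀ m, Zfree (f m)` of `WSlotT2OfPieces.t2Drift_of_rows` for the pointwise `Zfree`.  The map part dies by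
§2 (`λ` is `m`-free; NO pin), the source part by `hZ` at `m` and `m+1`.  Hypotheses: `1 ≤ Lc`, the mixed-table binders `hmix` (shape, ∃-form)
and `hmixt` (covariance — the hypothesis shape of an2's `T2Of_translate`), all colour constants symbolic. -/
theorem forcing_inner_eq_zero_of_source (hLc : 1 ≤ Lc) (hr : r ∈ box (d + 1) Lc) (cE cVH cΛ cE₂ cB : ℝ) (Tc : Fin 4 → Fin 4 → Fin 4 → Fin 4 → ℝ)
    {mixFF : Tab d} (hmix : ∃ C δ : ℝ, 0 < δ ∧ LocStencilFM Lc mixFF C δ)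
    (hmixt : ∀ (κ : Fin (d + 1)) (u : Fin (d + 1) → ℤ) (ρ : Fin (d + 1)) (w t : Fin (d + 1) → ℤ),
      mixFF κ (u + (Lc : ℤ) • t) ρ (w + t) = shiftK (-((Lc : ℤ) • t)) (mixFF κ u ρ w))
    (b : ℕ → Tab d) {Cb δb : ℝ} (hδb : 0 < δb) (hb : ∀ m, LocStencil₂ (b m) Cb δb)
    (hZ : ∀ (m : ℕ) (κ : Fin (d + 1)) (u : Fin (d + 1) → ℤ) (κ' α β : Fin (d + 1)),
      (∑' u', ∑' x, ∑' z, b m κ u κ' u' x z (Sum.inl α) (Sum.inl β)) = 0)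
    (m : ℕ) (κ : Fin (d + 1)) (u : Fin (d + 1) → ℤ) (κ' α β : Fin (d + 1)) :
    (∑' u', ∑' x, ∑' z,
      ((lin4 (cE₂ * (Lc : ℝ) ^ (2 * (d + 1))) (unitK (sfStep Lc (m + 1)) (smStep d Lc (m + 1)) (KInvStep (d := d) Lc (m + 1))) Lc
            (unitS₂ (sfStep Lc m) (smStep d Lc m) (T2Of d Lc cE cVH cΛ cE₂ cB Tc (vh₂SAt (toSite r) Lc) mixFF m))
          - lin4 (cE₂ * (Lc : ℝ) ^ (2 * (d + 1))) (unitK (sfStep Lc m) (smStep d Lc m) (KInvStep (d := d) Lc m)) Lc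
            (unitS₂ (sfStep Lc m) (smStep d Lc m) (T2Of d Lc cE cVH cΛ cE₂ cB Tc (vh₂SAt (toSite r) Lc) mixFF m)))
        + (b (m + 1) - b m)) κ u κ' u' x z (Sum.inl α) (Sum.inl β)) = 0 := by
  obtain ⟨CT, δT, hδT, hT⟩ := shape_member hLc hr cE cVH cΛ cE₂ cB Tc hmix m
  have hTcov := fun κ u κ' u' t => unitS₂_T2Of_translate_at hLc cE cVH cΛ cE₂ cB Tc (toSite r) hmixt m κ u κ' u' t
  obtain ⟨mi, Ci, hmi, hCi, hKi⟩ := decays_KInvStep (Lc := Lc) (d := d) (m + 1)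
  obtain ⟨mj, Cj, hmj, hCj, hKj⟩ := decays_KInvStep (Lc := Lc) (d := d) m
  have hLi := locStencil₂_lin4 (decays_unitK (sf := sfStep Lc (m + 1)) (sm := smStep d Lc (m + 1)) hKi) (by positivity) hmi hLc
    (cE₂ * (Lc : ℝ) ^ (2 * (d + 1))) hT hδT
  have hLj := locStencil₂_lin4 (decays_unitK (sf := sfStep Lc m) (sm := smStep d Lc m) hKj) (by positivity) hmj hLc
    (cE₂ * (Lc : ℝ) ^ (2 * (d + 1))) hT hδT
  have hr0 : 0 < min (min mi δT / 128) (min mj δT / 128) := by positivity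
  have hA := locStencil₂_sub (hLi.mono (min_le_left _ _)) (hLj.mono (min_le_right _ _))
  have hS := locStencil₂_sub (hb (m + 1)) (hb m)
  rw [inner_add_of_locStencil₂ hA hr0 hS hδb, inner_lin4_sub_lin4_step hLc (m + 1) m _ hT hδT hTcov,
    inner_sub_of_locStencil₂ (hb (m + 1)) hδb (hb m) hδb, hZ (m + 1), hZ m, sub_zero, add_zero]

/-- **ROW W3-F2b FROM ROW W3-F2a — CELL FORM (RULINGS-14b (R14-6), leaf-02's `zmode` at period `Lc`)** [folklore composition]: the same
with `Zfree X := ∀ κ κ′ α β, zmode Lc X κ κ′ (inl α) (inl β) = 0` on both sides (the map part by §2 at period `Lc`, the source part by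
`WSlotFirstDiff.zmode_sub`; no covariance of `b` is needed).  Stated at ANY period `N`. -/
theorem forcing_zmode_eq_zero_of_source (hLc : 1 ≤ Lc) (hr : r ∈ box (d + 1) Lc) (N : ℕ) (cE cVH cΛ cE₂ cB : ℝ) (Tc : Fin 4 → Fin 4 → Fin 4 → Fin 4 → ℝ)
    {mixFF : Tab d} (hmix : ∃ C δ : ℝ, 0 < δ ∧ LocStencilFM Lc mixFF C δ)
    (hmixt : ∀ (κ : Fin (d + 1)) (u : Fin (d + 1) → ℤ) (ρ : Fin (d + 1)) (w t : Fin (d + 1) → ℤ),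
      mixFF κ (u + (Lc : ℤ) • t) ρ (w + t) = shiftK (-((Lc : ℤ) • t)) (mixFF κ u ρ w))
    (b : ℕ → Tab d) {Cb δb : ℝ} (hδb : 0 < δb) (hb : ∀ m, LocStencil₂ (b m) Cb δb)
    (hZ : ∀ (m : ℕ) (κ κ' α β : Fin (d + 1)), zmode N (b m) κ κ' (Sum.inl α) (Sum.inl β) = 0)
    (m : ℕ) (κ κ' α β : Fin (d + 1)) :
    zmode N
      ((lin4 (cE₂ * (Lc : ℝ) ^ (2 * (d + 1))) (unitK (sfStep Lc (m + 1)) (smStep d Lc (m + 1)) (KInvStep (d := d) Lc (m + 1))) Lc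
            (unitS₂ (sfStep Lc m) (smStep d Lc m) (T2Of d Lc cE cVH cΛ cE₂ cB Tc (vh₂SAt (toSite r) Lc) mixFF m))
          - lin4 (cE₂ * (Lc : ℝ) ^ (2 * (d + 1))) (unitK (sfStep Lc m) (smStep d Lc m) (KInvStep (d := d) Lc m)) Lc
            (unitS₂ (sfStep Lc m) (smStep d Lc m) (T2Of d Lc cE cVH cΛ cE₂ cB Tc (vh₂SAt (toSite r) Lc) mixFF m)))
        + (b (m + 1) - b m)) κ κ' (Sum.inl α) (Sum.inl β) = 0 := by
  obtain ⟨CT, δT, hδT, hT⟩ := shape_member hLc hr cE cVH cΛ cE₂ cB Tc hmix m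
  have hTcov := fun κ u κ' u' t => unitS₂_T2Of_translate_at hLc cE cVH cΛ cE₂ cB Tc (toSite r) hmixt m κ u κ' u' t
  obtain ⟨mi, Ci, hmi, hCi, hKi⟩ := decays_KInvStep (Lc := Lc) (d := d) (m + 1)
  obtain ⟨mj, Cj, hmj, hCj, hKj⟩ := decays_KInvStep (Lc := Lc) (d := d) m
  have hLi := locStencil₂_lin4 (decays_unitK (sf := sfStep Lc (m + 1)) (sm := smStep d Lc (m + 1)) hKi) (by positivity) hmi hLc
    (cE₂ * (Lc : ℝ) ^ (2 * (d + 1))) hT hδT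
  have hLj := locStencil₂_lin4 (decays_unitK (sf := sfStep Lc m) (sm := smStep d Lc m) hKj) (by positivity) hmj hLc
    (cE₂ * (Lc : ℝ) ^ (2 * (d + 1))) hT hδT
  set rr : ℝ := min (min (min mi δT / 128) (min mj δT / 128)) δb with hr_def
  have hrr : 0 < rr := by rw [hr_def]; positivity
  have hr1 : rr ≤ min mi δT / 128 := by rw [hr_def]; exact (min_le_left _ _).trans (min_le_left _ _)
  have hr2 : rr ≤ min mj δT / 128 := by rw [hr_def]; exact (min_le_left _ _).trans (min_le_right _ _)
  have hr3 : rr ≤ δb := by rw [hr_def]; exact min_le_right _ _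
  have hA := locStencil₂_sub (hLi.mono hr1) (hLj.mono hr2)
  have hS := locStencil₂_sub ((hb (m + 1)).mono hr3) ((hb m).mono hr3)
  have e1 := zmode_add (N := N) hA hS hrr κ κ' (Sum.inl α) (Sum.inl β)
  have e2 := zmode_sub (N := N) ((hb (m + 1)).mono hr3) ((hb m).mono hr3) hrr κ κ' (Sum.inl α) (Sum.inl β)
  have e3 := zmode_lin4_sub_lin4_step hLc N (m + 1) m (cE₂ * (Lc : ℝ) ^ (2 * (d + 1))) hT hδT hTcov κ κ' α β
  -- the END's `Pi` spelling versus the lambda spelling of `zmode_add`∕`zmode_sub`: definitionally equal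
  have eA : zmode N ((lin4 (cE₂ * (Lc : ℝ) ^ (2 * (d + 1)))
        (unitK (sfStep Lc (m + 1)) (smStep d Lc (m + 1)) (KInvStep (d := d) Lc (m + 1))) Lc
          (unitS₂ (sfStep Lc m) (smStep d Lc m) (T2Of d Lc cE cVH cΛ cE₂ cB Tc (vh₂SAt (toSite r) Lc) mixFF m))
        - lin4 (cE₂ * (Lc : ℝ) ^ (2 * (d + 1))) (unitK (sfStep Lc m) (smStep d Lc m) (KInvStep (d := d) Lc m)) Lc
          (unitS₂ (sfStep Lc m) (smStep d Lc m) (T2Of d Lc cE cVH cΛ cE₂ cB Tc (vh₂SAt (toSite r) Lc) mixFF m)))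
        + (b (m + 1) - b m)) κ κ' (Sum.inl α) (Sum.inl β) = _ := e1
  have eS : zmode N (b (m + 1) - b m) κ κ' (Sum.inl α) (Sum.inl β) = _ := e2
  rw [eA, e3, eS, hZ (m + 1), hZ m, sub_zero, add_zero]

end Forcing

/-! ## §4 ROW W3-F2b LITERALLY: the bracket of record (leaf-04's `unitS₂_T2Of_succ_affine`, leaf-01's `T2UnitSplitLevels` forcing) -/

section Literal

variable {Lc : ℕ} [NeZero Lc] {r : Fin (d + 1) → ℕ}

/-- **ROW W3-F2b `hZf : ∀ m, Zfree (f m)` AT THE §8.3 INSTANTIATION, POINTWISE `Zfree` OF RECORD (ref2 R51-2 ∕ (w2)), AS A FUNCTION OF ROW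
W3-F2a** [folklore composition]: with `b m :=` leaf-04's bracket
`(cE₂·Lc^{2(d+1)}) • mmRead Lc (K3OfK K♮_m Lc S♮_m M♮_m (W2SymOfK K♮_m Lc S♮_m M♮_m 0 M₂♮_m)) + cB • mfNeg (vh₂SAt (toSite r) Lc)` and `f m` leaf-01's forcing
`(𝒜_{m+1} T♮_m − 𝒜_m T♮_m) + (b (m+1) − b m)` (the summand of `T2UnitSplitLevels.unitS₂_T2Of_sub_eq_transport_add_sum_vh₂S`, token for token):
ROW W3-F4a's shape conjunct `hb` and ROW W3-F2a `hZ` (pointwise) give `∀ κ u κ′ α β, Σ'_{u′xz} (f m) κ u κ′ u′ x z (inl α) (inl β) = 0`. -/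
theorem hZf_of_hZ_pointwise (hLc : 1 ≤ Lc) (hr : r ∈ box (d + 1) Lc) (cE cVH cΛ cE₂ cB : ℝ) (Tc : Fin 4 → Fin 4 → Fin 4 → Fin 4 → ℝ)
    {mixFF : Tab d} (hmix : ∃ C δ : ℝ, 0 < δ ∧ LocStencilFM Lc mixFF C δ)
    (hmixt : ∀ (κ : Fin (d + 1)) (u : Fin (d + 1) → ℤ) (ρ : Fin (d + 1)) (w t : Fin (d + 1) → ℤ),
      mixFF κ (u + (Lc : ℤ) • t) ρ (w + t) = shiftK (-((Lc : ℤ) • t)) (mixFF κ u ρ w))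
    {Cb δb : ℝ} (hδb : 0 < δb)
    (hb : ∀ m, LocStencil₂ (fun κ u κ' u' => (cE₂ * (Lc : ℝ) ^ (2 * (d + 1))) • mmRead Lc (K3OfK
          (unitK (sfStep Lc m) (smStep d Lc m) (KInvStep (d := d) Lc m)) Lc (unitS (sfStep Lc m) (smStep d Lc m) (Spure d Lc cE cVH cΛ m))
          (unitM (sfStep Lc m) (smStep d Lc m) (M1 d Lc cΛ m)) (W2SymOfK (unitK (sfStep Lc m) (smStep d Lc m) (KInvStep (d := d) Lc m)) Lc
          (unitS (sfStep Lc m) (smStep d Lc m) (Spure d Lc cE cVH cΛ m)) (unitM (sfStep Lc m) (smStep d Lc m) (M1 d Lc cΛ m)) 0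
          (unitM₂ (sfStep Lc m) (smStep d Lc m) (M2Of d Lc mixFF m))) κ u κ' u') + cB • mfNeg ((vh₂SAt (toSite r) Lc) κ u κ' u')) Cb δb)
    (hZ : ∀ (m : ℕ) (κ : Fin (d + 1)) (u : Fin (d + 1) → ℤ) (κ' α β : Fin (d + 1)),
      (∑' u', ∑' x, ∑' z, ((cE₂ * (Lc : ℝ) ^ (2 * (d + 1))) • mmRead Lc (K3OfK
          (unitK (sfStep Lc m) (smStep d Lc m) (KInvStep (d := d) Lc m)) Lc (unitS (sfStep Lc m) (smStep d Lc m) (Spure d Lc cE cVH cΛ m))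
          (unitM (sfStep Lc m) (smStep d Lc m) (M1 d Lc cΛ m)) (W2SymOfK (unitK (sfStep Lc m) (smStep d Lc m) (KInvStep (d := d) Lc m)) Lc
          (unitS (sfStep Lc m) (smStep d Lc m) (Spure d Lc cE cVH cΛ m)) (unitM (sfStep Lc m) (smStep d Lc m) (M1 d Lc cΛ m)) 0
          (unitM₂ (sfStep Lc m) (smStep d Lc m) (M2Of d Lc mixFF m))) κ u κ' u') + cB • mfNeg ((vh₂SAt (toSite r) Lc) κ u κ' u')) x z (Sum.inl α) (Sum.inl β)) = 0)
    (m : ℕ) (κ : Fin (d + 1)) (u : Fin (d + 1) → ℤ) (κ' α β : Fin (d + 1)) :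
    (∑' u', ∑' x, ∑' z,
      (((lin4 (cE₂ * (Lc : ℝ) ^ (2 * (d + 1))) (unitK (sfStep Lc (m + 1)) (smStep d Lc (m + 1)) (KInvStep (d := d) Lc (m + 1))) Lc
            (unitS₂ (sfStep Lc m) (smStep d Lc m) (T2Of d Lc cE cVH cΛ cE₂ cB Tc (vh₂SAt (toSite r) Lc) mixFF m))
          - lin4 (cE₂ * (Lc : ℝ) ^ (2 * (d + 1))) (unitK (sfStep Lc m) (smStep d Lc m) (KInvStep (d := d) Lc m)) Lc
            (unitS₂ (sfStep Lc m) (smStep d Lc m) (T2Of d Lc cE cVH cΛ cE₂ cB Tc (vh₂SAt (toSite r) Lc) mixFF m)))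
        + ((fun κ u κ' u' => (cE₂ * (Lc : ℝ) ^ (2 * (d + 1))) • mmRead Lc (K3OfK
              (unitK (sfStep Lc (m + 1)) (smStep d Lc (m + 1)) (KInvStep (d := d) Lc (m + 1))) Lc (unitS (sfStep Lc (m + 1)) (smStep d Lc (m + 1)) (Spure d Lc cE cVH cΛ (m + 1)))
              (unitM (sfStep Lc (m + 1)) (smStep d Lc (m + 1)) (M1 d Lc cΛ (m + 1))) (W2SymOfK (unitK (sfStep Lc (m + 1)) (smStep d Lc (m + 1)) (KInvStep (d := d) Lc (m + 1))) Lc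
              (unitS (sfStep Lc (m + 1)) (smStep d Lc (m + 1)) (Spure d Lc cE cVH cΛ (m + 1))) (unitM (sfStep Lc (m + 1)) (smStep d Lc (m + 1)) (M1 d Lc cΛ (m + 1))) 0
              (unitM₂ (sfStep Lc (m + 1)) (smStep d Lc (m + 1)) (M2Of d Lc mixFF (m + 1)))) κ u κ' u') + cB • mfNeg ((vh₂SAt (toSite r) Lc) κ u κ' u'))
          - (fun κ u κ' u' => (cE₂ * (Lc : ℝ) ^ (2 * (d + 1))) • mmRead Lc (K3OfK
              (unitK (sfStep Lc m) (smStep d Lc m) (KInvStep (d := d) Lc m)) Lc (unitS (sfStep Lc m) (smStep d Lc m) (Spure d Lc cE cVH cΛ m))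
              (unitM (sfStep Lc m) (smStep d Lc m) (M1 d Lc cΛ m)) (W2SymOfK (unitK (sfStep Lc m) (smStep d Lc m) (KInvStep (d := d) Lc m)) Lc
              (unitS (sfStep Lc m) (smStep d Lc m) (Spure d Lc cE cVH cΛ m)) (unitM (sfStep Lc m) (smStep d Lc m) (M1 d Lc cΛ m)) 0
              (unitM₂ (sfStep Lc m) (smStep d Lc m) (M2Of d Lc mixFF m))) κ u κ' u') + cB • mfNeg ((vh₂SAt (toSite r) Lc) κ u κ' u'))))) κ u κ' u' x z (Sum.inl α) (Sum.inl β)) = 0 :=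
  forcing_inner_eq_zero_of_source hLc hr cE cVH cΛ cE₂ cB Tc hmix hmixt
    (fun j => (fun κ u κ' u' => (cE₂ * (Lc : ℝ) ^ (2 * (d + 1))) • mmRead Lc (K3OfK
        (unitK (sfStep Lc j) (smStep d Lc j) (KInvStep (d := d) Lc j)) Lc (unitS (sfStep Lc j) (smStep d Lc j) (Spure d Lc cE cVH cΛ j))
        (unitM (sfStep Lc j) (smStep d Lc j) (M1 d Lc cΛ j)) (W2SymOfK (unitK (sfStep Lc j) (smStep d Lc j) (KInvStep (d := d) Lc j)) Lc
        (unitS (sfStep Lc j) (smStep d Lc j) (Spure d Lc cE cVH cΛ j)) (unitM (sfStep Lc j) (smStep d Lc j) (M1 d Lc cΛ j)) 0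
        (unitM₂ (sfStep Lc j) (smStep d Lc j) (M2Of d Lc mixFF j))) κ u κ' u') + cB • mfNeg ((vh₂SAt (toSite r) Lc) κ u κ' u'))) hδb hb hZ m κ u κ' α β

/-- **ROW W3-F2b AT THE §8.3 INSTANTIATION, CELL `Zfree` (RULINGS-14b (R14-6): `∀ κ κ′ α β, zmode Lc X κ κ′ (inl α) (inl β) = 0`), AS A FUNCTION OF
ROW W3-F2a** [folklore composition] — the same row for the cell instantiation (stated at any period `N`; the ENDs use `N := Lc`). -/
theorem hZf_of_hZ_cell (hLc : 1 ≤ Lc) (hr : r ∈ box (d + 1) Lc) (N : ℕ) (cE cVH cΛ cE₂ cB : ℝ) (Tc : Fin 4 → Fin 4 → Fin 4 → Fin 4 → ℝ)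
    {mixFF : Tab d} (hmix : ∃ C δ : ℝ, 0 < δ ∧ LocStencilFM Lc mixFF C δ)
    (hmixt : ∀ (κ : Fin (d + 1)) (u : Fin (d + 1) → ℤ) (ρ : Fin (d + 1)) (w t : Fin (d + 1) → ℤ),
      mixFF κ (u + (Lc : ℤ) • t) ρ (w + t) = shiftK (-((Lc : ℤ) • t)) (mixFF κ u ρ w))
    {Cb δb : ℝ} (hδb : 0 < δb)
    (hb : ∀ m, LocStencil₂ (fun κ u κ' u' => (cE₂ * (Lc : ℝ) ^ (2 * (d + 1))) • mmRead Lc (K3OfK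
          (unitK (sfStep Lc m) (smStep d Lc m) (KInvStep (d := d) Lc m)) Lc (unitS (sfStep Lc m) (smStep d Lc m) (Spure d Lc cE cVH cΛ m))
          (unitM (sfStep Lc m) (smStep d Lc m) (M1 d Lc cΛ m)) (W2SymOfK (unitK (sfStep Lc m) (smStep d Lc m) (KInvStep (d := d) Lc m)) Lc
          (unitS (sfStep Lc m) (smStep d Lc m) (Spure d Lc cE cVH cΛ m)) (unitM (sfStep Lc m) (smStep d Lc m) (M1 d Lc cΛ m)) 0
          (unitM₂ (sfStep Lc m) (smStep d Lc m) (M2Of d Lc mixFF m))) κ u κ' u') + cB • mfNeg ((vh₂SAt (toSite r) Lc) κ u κ' u')) Cb δb)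
    (hZ : ∀ (m : ℕ) (κ κ' α β : Fin (d + 1)), zmode N (fun κ u κ' u' => (cE₂ * (Lc : ℝ) ^ (2 * (d + 1))) • mmRead Lc (K3OfK
          (unitK (sfStep Lc m) (smStep d Lc m) (KInvStep (d := d) Lc m)) Lc (unitS (sfStep Lc m) (smStep d Lc m) (Spure d Lc cE cVH cΛ m))
          (unitM (sfStep Lc m) (smStep d Lc m) (M1 d Lc cΛ m)) (W2SymOfK (unitK (sfStep Lc m) (smStep d Lc m) (KInvStep (d := d) Lc m)) Lc
          (unitS (sfStep Lc m) (smStep d Lc m) (Spure d Lc cE cVH cΛ m)) (unitM (sfStep Lc m) (smStep d Lc m) (M1 d Lc cΛ m)) 0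
          (unitM₂ (sfStep Lc m) (smStep d Lc m) (M2Of d Lc mixFF m))) κ u κ' u') + cB • mfNeg ((vh₂SAt (toSite r) Lc) κ u κ' u')) κ κ' (Sum.inl α) (Sum.inl β) = 0)
    (m : ℕ) (κ κ' α β : Fin (d + 1)) :
    zmode N
      (((lin4 (cE₂ * (Lc : ℝ) ^ (2 * (d + 1))) (unitK (sfStep Lc (m + 1)) (smStep d Lc (m + 1)) (KInvStep (d := d) Lc (m + 1))) Lc
            (unitS₂ (sfStep Lc m) (smStep d Lc m) (T2Of d Lc cE cVH cΛ cE₂ cB Tc (vh₂SAt (toSite r) Lc) mixFF m))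
          - lin4 (cE₂ * (Lc : ℝ) ^ (2 * (d + 1))) (unitK (sfStep Lc m) (smStep d Lc m) (KInvStep (d := d) Lc m)) Lc
            (unitS₂ (sfStep Lc m) (smStep d Lc m) (T2Of d Lc cE cVH cΛ cE₂ cB Tc (vh₂SAt (toSite r) Lc) mixFF m)))
        + ((fun κ u κ' u' => (cE₂ * (Lc : ℝ) ^ (2 * (d + 1))) • mmRead Lc (K3OfK
              (unitK (sfStep Lc (m + 1)) (smStep d Lc (m + 1)) (KInvStep (d := d) Lc (m + 1))) Lc (unitS (sfStep Lc (m + 1)) (smStep d Lc (m + 1)) (Spure d Lc cE cVH cΛ (m + 1)))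
              (unitM (sfStep Lc (m + 1)) (smStep d Lc (m + 1)) (M1 d Lc cΛ (m + 1))) (W2SymOfK (unitK (sfStep Lc (m + 1)) (smStep d Lc (m + 1)) (KInvStep (d := d) Lc (m + 1))) Lc
              (unitS (sfStep Lc (m + 1)) (smStep d Lc (m + 1)) (Spure d Lc cE cVH cΛ (m + 1))) (unitM (sfStep Lc (m + 1)) (smStep d Lc (m + 1)) (M1 d Lc cΛ (m + 1))) 0
              (unitM₂ (sfStep Lc (m + 1)) (smStep d Lc (m + 1)) (M2Of d Lc mixFF (m + 1)))) κ u κ' u') + cB • mfNeg ((vh₂SAt (toSite r) Lc) κ u κ' u'))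
          - (fun κ u κ' u' => (cE₂ * (Lc : ℝ) ^ (2 * (d + 1))) • mmRead Lc (K3OfK
              (unitK (sfStep Lc m) (smStep d Lc m) (KInvStep (d := d) Lc m)) Lc (unitS (sfStep Lc m) (smStep d Lc m) (Spure d Lc cE cVH cΛ m))
              (unitM (sfStep Lc m) (smStep d Lc m) (M1 d Lc cΛ m)) (W2SymOfK (unitK (sfStep Lc m) (smStep d Lc m) (KInvStep (d := d) Lc m)) Lc
              (unitS (sfStep Lc m) (smStep d Lc m) (Spure d Lc cE cVH cΛ m)) (unitM (sfStep Lc m) (smStep d Lc m) (M1 d Lc cΛ m)) 0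
              (unitM₂ (sfStep Lc m) (smStep d Lc m) (M2Of d Lc mixFF m))) κ u κ' u') + cB • mfNeg ((vh₂SAt (toSite r) Lc) κ u κ' u'))))) κ κ' (Sum.inl α) (Sum.inl β) = 0 :=
  forcing_zmode_eq_zero_of_source hLc hr N cE cVH cΛ cE₂ cB Tc hmix hmixt
    (fun j => (fun κ u κ' u' => (cE₂ * (Lc : ℝ) ^ (2 * (d + 1))) • mmRead Lc (K3OfK
        (unitK (sfStep Lc j) (smStep d Lc j) (KInvStep (d := d) Lc j)) Lc (unitS (sfStep Lc j) (smStep d Lc j) (Spure d Lc cE cVH cΛ j))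
        (unitM (sfStep Lc j) (smStep d Lc j) (M1 d Lc cΛ j)) (W2SymOfK (unitK (sfStep Lc j) (smStep d Lc j) (KInvStep (d := d) Lc j)) Lc
        (unitS (sfStep Lc j) (smStep d Lc j) (Spure d Lc cE cVH cΛ j)) (unitM (sfStep Lc j) (smStep d Lc j) (M1 d Lc cΛ j)) 0
        (unitM₂ (sfStep Lc j) (smStep d Lc j) (M2Of d Lc mixFF j))) κ u κ' u') + cB • mfNeg ((vh₂SAt (toSite r) Lc) κ u κ' u'))) hδb hb hZ m κ κ' α β

end Literal

end Summit.QuantumFields.BalabanUV.Beta.GAN24.WSlotForcingZeroModeRoot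

end
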